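import Literature.NumberTheory.IwasawaTheory.ClassicalMuVanishesDivisionFieldThree
import Literature.NumberTheory.EllipticCurves.FineSelmerClassGroupCriterion
import HarnessLib

set_option autoImplicit false

/-!
# Statement (A) of Coates–Sujatha at `p = 3` for curves with Cartan-normaliser mod-3 image, from `μ(ℚ(P)) = 0`
# (road (b): `CoatesSujatha2005.thm34` ∘ `ClassicalMuVanishesDivisionFieldThree`)

Topic `NumberTheory/EllipticCurves`; THEOREM-ONLY file (no definition, no named fact, no `sorry`); literature seat `bsd-potss-conjA-anchor`
g11 (supports the K9 / KT fine-Selmer cruxes stmt-BirchSwinnertonDyer-19386 / 19413 and their residue parents 19942 / 19916; closes nothing).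
The composites of the named fact `CoatesSujatha2005.thm34_fineSelmerDual_moduleFinite_of_classicalMuVanishes_divisionField` (road (b):
classical `μ = 0` for `ℚ(E[p])_cyc` ⇒ statement (A)) with the `ℚ(E[3])`-level theorems of
`IwasawaTheory/ClassicalMuVanishesDivisionFieldThree.lean`: for `E/ℚ` elliptic whose mod-`3` image is contained in the normaliser of a
split Cartan subgroup (`HasSplitCartanNormalizerModPImage E 3`) — resp. equals the normaliser of a non-split Cartan subgroup
(`HasModPImageEqNonsplitCartanNormalizer E 3`) — statement (A) for `E` at `3` (`Sel₀(E/ℚ_cyc)^∨` finitely generated over `ℤ_3`, in the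
tree's `∃ γ D, Module.Finite ℤ_[3] D.X` form) follows from: one `τ ∈ Γ_ℚ` acting on `E[3]` as an involution `≠ 1, −1` (the involution fixing
a `3`-torsion point `P`), «`μ = 0` for every cyclotomic `ℤ_3`-extension of the fixed field of `τ|_{ℚ(E[3])}`» (`= ℚ(P)`; non-split fact-free
form: also of `ℚ(x(P))`, the fixed field of `⟨τ, τ₋⟩`, `τ₋` acting as `−1`), Ferrero–Washington, and Coates–Sujatha Thm. 3.4.  No growth
theorem (except in the primed non-split form), no tower identification, no group-element bookkeeping.

References: [CoatesSujatha2005, Thm. 3.4]; [KuriharaPollack2007, §3.1]; [Lemmermeyer1994, §1]; [Washington1997, §7.5, §13.1]; [Serre1972, §2.2].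
-/

noncomputable section

open scoped NumberField

open Field IntermediateField WeierstrassCurve Literature.NumberTheory.EllipticCurves Literature.NumberTheory.GaloisRepresentations
  Literature.NumberTheory.SerreUniformity Literature.NumberTheory.IwasawaTheory

namespace Literature.NumberTheory.EllipticCurves.CoatesSujatha2005

/-- **Statement (A) at `3` for split-Cartan image, from `μ(ℚ(P)) = 0`** (modulo Coates–Sujatha Thm. 3.4 and Ferrero–Washington, both
named facts): `E/ℚ` elliptic with `HasSplitCartanNormalizerModPImage E 3`, `τ ∈ Γ_ℚ` with `τ² = 1`, `τ ≠ 1`, `τ ≠ −1` on `E[3]`, and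
`μ = 0` for every cyclotomic `ℤ_3`-extension of the fixed field of `τ|_{ℚ(E[3])}`; then for every cyclotomic `ℤ_3`-extension `κ` of `ℚ`
the dual fine Selmer group over `ℚ_cyc` is finitely generated over `ℤ_3`.
[cite: CoatesSujatha2005, Thm. 3.4 (§3)] [cite: KuriharaPollack2007, §3.1] [cite: Lemmermeyer1994, §1 (Kuroda's class number formula)] -/
theorem fineSelmerDual_moduleFinite_of_hasSplitCartanNormalizerModPImage_three
    (hCS : thm34_fineSelmerDual_moduleFinite_of_classicalMuVanishes_divisionField)
    (hFW : ferreroWashington1979_classicalMuVanishes) (W : WeierstrassCurve ℚ) [W.IsElliptic]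
    (himg : HasSplitCartanNormalizerModPImage W 3) (τ : absoluteGaloisGroup ℚ)
    (hτ2 : ∀ T : W.geomTorsion (3 : ℕ), τ • (τ • T) = T) (hτ1 : ∃ T : W.geomTorsion (3 : ℕ), τ • T ≠ T)
    (hτm : ∃ T : W.geomTorsion (3 : ℕ), τ • T ≠ -T)
    (hμ : ∀ κE : ZpExtension ↥(fixedField (Subgroup.zpowers (absRestrictNormalHom (W.divisionField 3) τ))) 3,
      κE.IsCyclotomic → ClassicalMuVanishes κE)
    (κ : ZpExtension ℚ 3) (hκ : κ.IsCyclotomic) :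
    ∃ (γ : absoluteGaloisGroup ℚ) (D : W.FineSelmerDualData κ γ), Module.Finite ℤ_[3] (RestrictScalars ℤ_[3] (IwasawaAlgebra 3) D.X) :=
  hCS W 3 (by decide)
    (classicalMuVanishes_divisionField_of_hasSplitCartanNormalizerModPImage_three hFW W himg τ hτ2 hτ1 hτm hμ) κ hκ

/-- **Statement (A) at `3` for image equal to a non-split Cartan normaliser, from `μ(ℚ(P)) = 0` and `μ(ℚ(x P)) = 0`** (modulo
Coates–Sujatha Thm. 3.4 and Ferrero–Washington): `HasModPImageEqNonsplitCartanNormalizer E 3`, `τ` as above, `τ₋ ∈ Γ_ℚ` acting as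
`−1` on `E[3]`, and `μ = 0` for every cyclotomic `ℤ_3`-extension of the fixed fields of `τ|_{ℚ(E[3])}` and of `⟨τ, τ₋⟩|_{ℚ(E[3])}`.
[cite: CoatesSujatha2005, Thm. 3.4 (§3)] [cite: KuriharaPollack2007, §3.1] [cite: Lemmermeyer1994, §1 (Kuroda's class number formula)] -/
theorem fineSelmerDual_moduleFinite_of_hasModPImageEqNonsplitCartanNormalizer_three
    (hCS : thm34_fineSelmerDual_moduleFinite_of_classicalMuVanishes_divisionField)
    (hFW : ferreroWashington1979_classicalMuVanishes) (W : WeierstrassCurve ℚ) [W.IsElliptic]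
    (himg : HasModPImageEqNonsplitCartanNormalizer W 3) (τ τm : absoluteGaloisGroup ℚ)
    (hτ2 : ∀ T : W.geomTorsion (3 : ℕ), τ • (τ • T) = T) (hτ1 : ∃ T : W.geomTorsion (3 : ℕ), τ • T ≠ T)
    (hτm : ∃ T : W.geomTorsion (3 : ℕ), τ • T ≠ -T) (hm : ∀ T : W.geomTorsion (3 : ℕ), τm • T = -T)
    (hμ : ∀ κE : ZpExtension ↥(fixedField (Subgroup.zpowers (absRestrictNormalHom (W.divisionField 3) τ))) 3,
      κE.IsCyclotomic → ClassicalMuVanishes κE)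
    (hμ' : ∀ κE : ZpExtension ↥(fixedField (Subgroup.zpowers (absRestrictNormalHom (W.divisionField 3) τ) ⊔
        Subgroup.zpowers (absRestrictNormalHom (W.divisionField 3) τm))) 3, κE.IsCyclotomic → ClassicalMuVanishes κE)
    (κ : ZpExtension ℚ 3) (hκ : κ.IsCyclotomic) :
    ∃ (γ : absoluteGaloisGroup ℚ) (D : W.FineSelmerDualData κ γ), Module.Finite ℤ_[3] (RestrictScalars ℤ_[3] (IwasawaAlgebra 3) D.X) :=
  hCS W 3 (by decide)
    (classicalMuVanishes_divisionField_of_hasModPImageEqNonsplitCartanNormalizer_three hFW W himg τ τm hτ2 hτ1 hτm hm hμ hμ') κ hκ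

/-- **The same with the input for `ℚ(P)` alone, paying Iwasawa's growth theorem** `iwasawa1959_classNumberPExp_growth` (`ℚ(x P) ⊆ ℚ(P)`
has `3`-prime index). [cite: CoatesSujatha2005, Thm. 3.4 (§3)] [cite: KuriharaPollack2007, §3.1] [cite: Washington1997, §13.1] -/
theorem fineSelmerDual_moduleFinite_of_hasModPImageEqNonsplitCartanNormalizer_three'
    (hCS : thm34_fineSelmerDual_moduleFinite_of_classicalMuVanishes_divisionField)
    (hI : iwasawa1959_classNumberPExp_growth) (hFW : ferreroWashington1979_classicalMuVanishes) (W : WeierstrassCurve ℚ)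
    [W.IsElliptic] (himg : HasModPImageEqNonsplitCartanNormalizer W 3) (τ : absoluteGaloisGroup ℚ)
    (hτ2 : ∀ T : W.geomTorsion (3 : ℕ), τ • (τ • T) = T) (hτ1 : ∃ T : W.geomTorsion (3 : ℕ), τ • T ≠ T)
    (hτm : ∃ T : W.geomTorsion (3 : ℕ), τ • T ≠ -T)
    (hμ : ∀ κE : ZpExtension ↥(fixedField (Subgroup.zpowers (absRestrictNormalHom (W.divisionField 3) τ))) 3,
      κE.IsCyclotomic → ClassicalMuVanishes κE)
    (κ : ZpExtension ℚ 3) (hκ : κ.IsCyclotomic) :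
    ∃ (γ : absoluteGaloisGroup ℚ) (D : W.FineSelmerDualData κ γ), Module.Finite ℤ_[3] (RestrictScalars ℤ_[3] (IwasawaAlgebra 3) D.X) :=
  hCS W 3 (by decide)
    (classicalMuVanishes_divisionField_of_hasModPImageEqNonsplitCartanNormalizer_three' hI hFW W himg τ hτ2 hτ1 hτm hμ) κ hκ

end Literature.NumberTheory.EllipticCurves.CoatesSujatha2005

end
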